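import Summits.ABC.IUTFork.Cor312Ind3IteratesVacuityRamificationCriterion
import Summits.ABC.IUTFork.Cor312Ind3IteratesVacuityWildDyadicEmpty
import Summits.ABC.IUTFork.Cor312Ind3IteratesVacuityWildDyadicInhabited
import Summits.ABC.IUTFork.Cor312Ind3IteratesVacuityWildDyadic
import Mathlib.FieldTheory.SplittingField.Construction
import HarnessLib

/-!
# [IUTchIII] Thm 3.11 (ii) (Ind3), honest model: NUMBER FIELDS REALISING every case of the ramification criterion
# (abc-iut cell, wave-5 seat abc-iut-w5-d172, gen 6; record-only, D-0012; proof-only, 0 definitions)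

S. Mochizuki, *Inter-universal Teichmüller theory III*, kurims manuscript (May 2020), Prop. 3.5 (ii) (a)(b)
pp. 104–105, Rmk. 1.1.1 (i) p. 28 [claim: Mochizuki2012, status: disputed].

CONTEXT (the cell's (G-PINNED)/(Ind3) honest-model census, VERDICT §4 (iii)). In abc-iut-w4-d029's honest model of
the (Ind3) iterates with abc-iut-c312-5's analytic logarithms, the depth-`m′ ≥ 2` clauses at a finite place `v` of a
number field `F` read "some `log_v(u)`, `u ∈ O_v^×`, is a unit" (this seat gen 0, `Cor312Ind3IteratesVacuityBoundary`).
abc-iut-w5-d017 (gen 5) settled the local criterion at the level of a PLACE: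
* `p_v` odd: depth `≥ 2` EMPTY iff `p_v ∤ e(v|p_v)` (`Real.nonarchIterImage_add_two_eq_empty_of_not_dvd`,
  `Real.nonarchIterImage_analyticLogv_two_nonempty_of_dvd`, `Cor312Ind3IteratesVacuityRamificationCriterion`);
* `p_v = 2`, `2 ∣ e(v|2)`, `f(v|2) ≥ 2`: depth `2` INHABITED (`Real.nonarchIterImage_analyticLogv_two_nonempty_of_two_dvd`,
  `Cor312Ind3IteratesVacuityWildDyadicInhabited`);
* `p_v = 2`, `f(v|2) = 1`, `e(v|2) ≡ 2 (mod 4)`: depth `≥ 2` EMPTY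
  (`Real.nonarchIterImage_add_two_eq_empty_of_inertiaDeg_eq_one`, `Cor312Ind3IteratesVacuityWildDyadicEmpty`).
THIS FILE supplies, for EACH of these cases, an actual number field and place realising it (the pattern of this
seat's gen-2 instances `ℚ(∛3)` p419392, `ℚ(∜3)` p421629, `ℚ(√2)` p424522, `ℚ(ᵖ√p)` p425849), so that every sentence
of the census is witnessed at the `F`-level and not only at the MLF level:

* §0 (toolkit, generalising this seat's ad-hoc degree-2/3/4 lemmas): `Real.le_ramificationIdx_of_pow_eq_prime` —
  an `n`-th root of `p` in `F_v`, `p ∈ 𝔭_v`, forces `n ≤ e(v|p)` (`‖x‖ⁿ = p⁻¹` and discreteness `‖x‖ ≤ p^{−1/e}`);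
  `Real.ramificationIdx_eq_and_inertiaDeg_eq_one_of_pow_eq_prime` — if moreover `[F:ℚ] ≤ n` then `e(v|p) = n`,
  `f(v|p) = 1` (`e·f ≤ [F:ℚ]`); `Real.exists_numberField_aeval_eq_zero_finrank_le` — Kronecker: a number field
  `ℚ[X]/(g)`, `g` an irreducible factor of `f`, of degree `≤ deg f` with a root of `f`;
  `Real.residueDegree_ne_one_of_sq_add_self_add_one_eq_zero` — a `2`-adic field containing a primitive cube root
  of unity `ω` has residue degree `≥ 2` (`‖3‖ = ‖1 − ω‖·‖ω + 2‖ < 1` if `ω` were a principal unit, while `‖3‖ = 1`).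
* §1 (`p ∤ e`, BEYOND the tame threshold): for every prime `p`, `F = ℚ[X]/(g)`, `g ∣ X^{p+1} − p`, and any
  `v ∣ p`: `e(v|p) = p + 1 > p − 1`, `f(v|p) = 1`, `p ∤ e`, and every honest depth-`≥ 2` image is EMPTY
  (`Real.exists_numberField_ramificationIdx_eq_succ_nonarchIterImage_eq_empty`) — the tame hypothesis
  `e ≤ p_v − 1` of this seat's gen-0 p414009 fails there at EVERY prime, yet the images are empty; and, on the
  other side of the criterion, for every odd `p` and `m ≥ 1`, `F = ℚ[X]/(g)`, `g ∣ X^{mp} − p`: `e(v|p) = m·p`,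
  `f(v|p) = 1`, depth `2` INHABITED (`Real.exists_numberField_ramificationIdx_eq_mul_nonarchIterImage_two_nonempty`).
* §2 (`p = 2`, `f = 1`, `e = 2k`, `k` odd): `F = ℚ[X]/(g)`, `g ∣ X^{2k} − 2`: `e(v|2) = 2k`, `f(v|2) = 1`, depth `≥ 2`
  EMPTY (`Real.exists_numberField_dyadic_ramificationIdx_eq_two_mul_nonarchIterImage_eq_empty`).
* §3 (`p = 2`, `e = f = 2`, INHABITED): `F = ℚ[X]/(g)`, `g ∣ X⁴ + 2X² + 4` (a root `θ` gives `ζ₃ = θ²/2` and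
  `√2 = −θ³/2`), any `v ∣ 2`: `e(v|2) = 2`, `f(v|2) = 2`, and the honest depth-`2` image is NONEMPTY
  (`Real.exists_numberField_dyadic_inertiaDeg_two_nonarchIterImage_two_nonempty`) — the first `F`-level dyadic
  INHABITED instance of the census.

HONEST FRAMING: classical algebraic number theory about the cell's MODEL of the (Ind3) iterates; nothing here
asserts or denies [IUTchIII] Cor. 3.12 or takes a side; census ≠ verdict; typed ≠ proved. No definition, no
Prop-valued fact (D-0067 (1)). [cite: NeukirchANT1999, Ch. II (5.5), Prop. (6.8)] [cite: Lang2002, Ch. V §2 Prop. 2.3]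
-/

noncomputable section

open Set Polynomial

namespace Summit.ABC.IUTFork.Thm311.Real

open NumberField IsDedekindDomain Literature.IUT.LogVolume Literature.IUT.LogThetaLattice
  Literature.NumberTheory.NumberFields

variable {F : Type} [Field F] [NumberField F]

/-! ## §0. Toolkit: `n`-th roots of `p` and ramification; Kronecker fields; cube roots of unity at `2` -/

/-- In the rescaled completion at a place over `p`: **`xⁿ = p` forces `n ≤ e`** (`‖x‖ⁿ = p⁻¹ < 1`, so `‖x‖ < 1`,
so `‖x‖ ≤ p^{−1/e}` by discreteness, so `p⁻¹ ≤ p^{−n/e}`). [cite: NeukirchANT1999, Ch. II (5.5)] -/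
theorem le_absRamificationIdx_rescaled_of_pow_eq_prime (v : HeightOneSpectrum (𝓞 F)) (p : ℕ) [Fact p.Prime]
    (hv : ((p : ℕ) : 𝓞 F) ∈ v.asIdeal) {n : ℕ} (x : RescaledCompletion F p v hv)
    (hx : x ^ n = (p : RescaledCompletion F p v hv)) :
    n ≤ absRamificationIdx p (RescaledCompletion F p v hv) := by
  have hp1 : (1 : ℝ) < p := by exact_mod_cast (Fact.out : p.Prime).one_lt
  have hp0 : (0 : ℝ) < p := by positivity
  have hnormn : ‖x‖ ^ n = (p : ℝ)⁻¹ := by rw [← norm_pow, hx, norm_prime p (RescaledCompletion F p v hv)]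
  have hxlt : ‖x‖ < 1 := by
    refine lt_of_not_ge fun h => ?_
    have h1 : (1 : ℝ) ≤ ‖x‖ ^ n := one_le_pow₀ h
    rw [hnormn] at h1
    have h2 : (p : ℝ)⁻¹ < 1 := inv_lt_one_of_one_lt₀ hp1
    linarith
  have hdisc := norm_le_rpow_of_norm_lt_one p (RescaledCompletion F p v hv) hxlt
  set e := absRamificationIdx p (RescaledCompletion F p v hv) with hedef
  have he0 : (0 : ℝ) < e := by exact_mod_cast absRamificationIdx_pos p (RescaledCompletion F p v hv)
  have h4 : ‖x‖ ^ n ≤ ((p : ℝ) ^ (-(1 / (e : ℝ)))) ^ n := pow_le_pow_left₀ (norm_nonneg _) hdisc n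
  rw [hnormn, ← Real.rpow_natCast, ← Real.rpow_mul hp0.le, ← Real.rpow_neg_one,
    Real.rpow_le_rpow_left_iff hp1, neg_mul, neg_le_neg_iff, one_div, inv_mul_eq_div, div_le_one he0] at h4
  exact_mod_cast h4

/-- **`xⁿ = p` in `F_v` with `p ∈ 𝔭_v` ⇒ `n ≤ e(v|p)`** (abc-iut-S7's `e(F_v) = e(v|p)`).
[cite: NeukirchANT1999, Ch. II Prop. (6.8)] -/
theorem le_ramificationIdx_of_pow_eq_prime (v : HeightOneSpectrum (𝓞 F)) {p : ℕ} (hp : p.Prime)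
    (hv : ((p : ℕ) : 𝓞 F) ∈ v.asIdeal) {n : ℕ} (x : v.adicCompletion F)
    (hx : x ^ n = (p : v.adicCompletion F)) : n ≤ v.asIdeal.ramificationIdx ℤ := by
  haveI : Fact p.Prime := ⟨hp⟩
  have h := le_absRamificationIdx_rescaled_of_pow_eq_prime v p hv (RescaledCompletion.of F p v hv x)
    (by rw [← map_pow, hx, map_natCast])
  rwa [absRamificationIdx_rescaledCompletion] at h

/-- **`xⁿ = p` in `F_v`, `p ∈ 𝔭_v`, `[F:ℚ] ≤ n` ⇒ `e(v|p) = n` and `f(v|p) = 1`** (`n ≤ e`, `e·f ≤ [F:ℚ] ≤ n`,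
`f ≥ 1`). [cite: NeukirchANT1999, Ch. II Prop. (6.8)] -/
theorem ramificationIdx_eq_and_inertiaDeg_eq_one_of_pow_eq_prime (v : HeightOneSpectrum (𝓞 F)) {p : ℕ}
    (hp : p.Prime) (hv : ((p : ℕ) : 𝓞 F) ∈ v.asIdeal) {n : ℕ} (hn : n ≠ 0) (x : v.adicCompletion F)
    (hx : x ^ n = (p : v.adicCompletion F)) (hdeg : Module.finrank ℚ F ≤ n) :
    v.asIdeal.ramificationIdx ℤ = n ∧ v.asIdeal.inertiaDeg ℤ = 1 := by
  have hne := le_ramificationIdx_of_pow_eq_prime v hp hv x hx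
  have hef : v.asIdeal.ramificationIdx ℤ * v.asIdeal.inertiaDeg ℤ ≤ n :=
    (ramificationIdx_mul_inertiaDeg_le_finrank' v).trans hdeg
  haveI := v.isPrime
  have hfpos : 0 < v.asIdeal.inertiaDeg ℤ := Ideal.inertiaDeg_pos (R := ℤ) (q := v.asIdeal)
  have he : v.asIdeal.ramificationIdx ℤ ≤ n := by
    calc v.asIdeal.ramificationIdx ℤ = v.asIdeal.ramificationIdx ℤ * 1 := (mul_one _).symm
      _ ≤ v.asIdeal.ramificationIdx ℤ * v.asIdeal.inertiaDeg ℤ := Nat.mul_le_mul_left _ hfpos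
      _ ≤ n := hef
  have heq : v.asIdeal.ramificationIdx ℤ = n := le_antisymm he hne
  refine ⟨heq, le_antisymm ?_ hfpos⟩
  rw [heq] at hef
  have hn0 : 0 < n := Nat.pos_of_ne_zero hn
  refine le_of_not_gt fun hf => ?_
  have : n * 2 ≤ n * v.asIdeal.inertiaDeg ℤ := Nat.mul_le_mul_left _ hf
  omega

/-- **Kronecker's construction over `ℚ`**: for a polynomial `f ∈ ℚ[X]` of degree `≥ 1` there is a number field
`F = ℚ[X]/(g)`, `g` an irreducible factor of `f`, with a root of `f` and `[F:ℚ] ≤ deg f`.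
[cite: Lang2002, Ch. V §2 Prop. 2.3] -/
theorem exists_numberField_aeval_eq_zero_finrank_le (f : ℚ[X]) (hfne : f.natDegree ≠ 0) :
    ∃ (F : Type) (_ : Field F) (_ : NumberField F) (θ : F), aeval θ f = 0 ∧ Module.finrank ℚ F ≤ f.natDegree := by
  haveI : Fact (Irreducible f.factor) := ⟨irreducible_factor f⟩
  have hg0 : f.factor ≠ 0 := (irreducible_factor f).ne_zero
  have hf0 : f ≠ 0 := by
    rintro rfl
    exact hfne natDegree_zero
  haveI : Module.Finite ℚ (AdjoinRoot f.factor) := (AdjoinRoot.powerBasis hg0).finite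
  haveI : CharZero (AdjoinRoot f.factor) :=
    charZero_of_injective_algebraMap (algebraMap ℚ (AdjoinRoot f.factor)).injective
  haveI : NumberField (AdjoinRoot f.factor) := NumberField.mk
  refine ⟨AdjoinRoot f.factor, inferInstance, inferInstance, AdjoinRoot.root f.factor, ?_, ?_⟩
  · have hdvd : f.factor ∣ f := factor_dvd_of_natDegree_ne_zero hfne
    have halg : algebraMap ℚ (AdjoinRoot f.factor) = AdjoinRoot.of f.factor := Subsingleton.elim _ _
    have hroot : aeval (AdjoinRoot.root f.factor) f.factor = 0 := by
      rw [aeval_def, halg]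
      exact AdjoinRoot.eval₂_root f.factor
    exact aeval_eq_zero_of_dvd_aeval_eq_zero hdvd hroot
  · rw [(AdjoinRoot.powerBasis hg0).finrank, AdjoinRoot.powerBasis_dim]
    exact natDegree_le_of_dvd (factor_dvd_of_natDegree_ne_zero hfne) hf0

/-- **A number field with an `n`-th root of `c`** (`n ≥ 1`, `c ∈ ℕ`): `ℚ[X]/(g)`, `g ∣ Xⁿ − c` irreducible, of degree
`≤ n`. [cite: Lang2002, Ch. V §2 Prop. 2.3] -/
theorem exists_numberField_pow_eq_natCast_finrank_le {n : ℕ} (hn : n ≠ 0) (c : ℕ) :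
    ∃ (F : Type) (_ : Field F) (_ : NumberField F) (α : F), α ^ n = (c : F) ∧ Module.finrank ℚ F ≤ n := by
  let f : ℚ[X] := X ^ n - C (c : ℚ)
  have hf : f.natDegree = n := natDegree_X_pow_sub_C
  obtain ⟨F, _, _, α, hα, hdeg⟩ := exists_numberField_aeval_eq_zero_finrank_le f (by rw [hf]; exact hn)
  refine ⟨F, inferInstance, inferInstance, α, ?_, by rwa [hf] at hdeg⟩
  have h1 : aeval α f = α ^ n - (c : F) := by simp [f, map_natCast]
  rw [h1, sub_eq_zero] at hα
  exact hα

/-- An `n`-th root of `c` in `F` gives one in every completion. [folklore] -/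
theorem exists_pow_eq_natCast_adicCompletion {n c : ℕ} {α : F} (hα : α ^ n = (c : F))
    (v : HeightOneSpectrum (𝓞 F)) : ∃ x : v.adicCompletion F, x ^ n = (c : v.adicCompletion F) :=
  ⟨algebraMap F (v.adicCompletion F) α, by rw [← map_pow, hα, map_natCast]⟩

/-- **A `2`-adic field containing a primitive cube root of unity has residue degree `≠ 1`**: if `ω² + ω + 1 = 0` and
`f = 1`, the unit `ω` would be principal (abc-iut-w5-d172 gen 2, `WildDyadic.isPrincipal_of_residueDegree_eq_one`:
over `𝔽₂` every unit is `≡ 1`), and `3 = (1 − ω)(ω + 2)` would have norm `< 1` — but `‖3‖ = 1`.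
[cite: NeukirchANT1999, Ch. II (5.5)] -/
theorem residueDegree_ne_one_of_sq_add_self_add_one_eq_zero {K : Type*} [NontriviallyNormedField K]
    [NormedAlgebra ℚ_[2] K] [IsUltrametricDist K] [ProperSpace K] (ω : K) (hω : ω ^ 2 + ω + 1 = 0) :
    residueDegree 2 K ≠ 1 := by
  intro hf
  have hω3 : ω ^ 3 = 1 := by linear_combination (ω - 1) * hω
  have hnorm : ‖ω‖ = 1 := by
    have h := congrArg (‖·‖) hω3
    simp only [norm_pow, norm_one] at h
    exact (pow_eq_one_iff_of_nonneg (norm_nonneg ω) (by norm_num : (3 : ℕ) ≠ 0)).mp h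
  have hprinc : ‖1 - ω‖ < 1 := WildDyadic.isPrincipal_of_residueDegree_eq_one hf hnorm
  have h3 : (3 : K) = (1 - ω) * (ω + 2) := by linear_combination hω
  have hn3 : ‖(3 : K)‖ = 1 := by
    have h := norm_natCast_eq_one_of_not_dvd 2 (K := K) (m := 3) (by norm_num)
    simpa using h
  have hω2 : ‖ω + 2‖ ≤ 1 := by
    refine (IsUltrametricDist.norm_add_le_max ω 2).trans (max_le hnorm.le ?_)
    rw [WildDyadic.norm_two]
    norm_num
  have hlt : ‖(3 : K)‖ < 1 := by
    rw [h3, norm_mul]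
    exact mul_lt_one_of_nonneg_of_lt_one_left (norm_nonneg _) hprinc hω2
  rw [hn3] at hlt
  exact lt_irrefl _ hlt

/-- **A primitive cube root of unity in `F_v`, `2 ∈ 𝔭_v` ⇒ `2 ≤ f(v|2)`** (abc-iut-S7's `f(F_v) = f(v|2)`).
[cite: NeukirchANT1999, Ch. II Prop. (6.8)] -/
theorem two_le_inertiaDeg_of_sq_add_self_add_one_eq_zero (v : HeightOneSpectrum (𝓞 F))
    (h2 : ((2 : ℕ) : 𝓞 F) ∈ v.asIdeal) (ω : v.adicCompletion F) (hω : ω ^ 2 + ω + 1 = 0) :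
    2 ≤ v.asIdeal.inertiaDeg ℤ := by
  haveI : Fact (Nat.Prime 2) := ⟨Nat.prime_two⟩
  set ω' := RescaledCompletion.of F 2 v h2 ω with hω'
  have hω'eq : ω' ^ 2 + ω' + 1 = 0 := by
    rw [hω', ← map_pow, ← map_add, ← map_one (RescaledCompletion.of F 2 v h2), ← map_add, hω, map_zero]
  have hne := residueDegree_ne_one_of_sq_add_self_add_one_eq_zero ω' hω'eq
  rw [residueDegree_rescaledCompletion] at hne
  haveI := v.isPrime
  have hfpos : 0 < v.asIdeal.inertiaDeg ℤ := Ideal.inertiaDeg_pos (R := ℤ) (q := v.asIdeal)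
  omega

/-! ## §1. `p ∤ e(v|p) = p + 1`: EMPTY beyond the tame threshold, at every prime -/

/-- **EXISTENCE AT EVERY PRIME, EMPTY SIDE**: for every prime `p` (odd, or `p = 2` with `e = 3` odd) there are a
number field `F` (`= ℚ[X]/(g)`, `g ∣ X^{p+1} − p`) and a finite place `v` with `p_v = p`, `e(v|p) = p + 1`,
`f(v|p) = 1` — so `p ∤ e` and the tame hypothesis `e(v|p_v) ≤ p_v − 1` of p414009 FAILS — at which every honest
depth-`≥ 2` (Ind3) iterate image for the analytic logarithms is EMPTY (abc-iut-w5-d017's criterion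
`Real.nonarchIterImage_add_two_eq_empty_of_not_dvd`; `p = 3` is this seat's `ℚ(∜3)` p421629).
[claim: Mochizuki2012, status: disputed] -/
theorem exists_numberField_ramificationIdx_eq_succ_nonarchIterImage_eq_empty {p : ℕ} (hp : p.Prime) :
    ∃ (F : Type) (_ : Field F) (_ : NumberField F) (v : HeightOneSpectrum (𝓞 F)),
      residueChar F v = p ∧ v.asIdeal.ramificationIdx ℤ = p + 1 ∧ v.asIdeal.inertiaDeg ℤ = 1 ∧
        ¬ residueChar F v ∣ v.asIdeal.ramificationIdx ℤ ∧ ¬ v.asIdeal.ramificationIdx ℤ ≤ residueChar F v - 1 ∧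
          ∀ k : ℕ, nonarchIterImage (analyticLogv F) v (k + 2) = ∅ := by
  obtain ⟨F, _, _, α, hα, hdeg⟩ := exists_numberField_pow_eq_natCast_finrank_le (n := p + 1) (by omega) p
  obtain ⟨v, hv⟩ := exists_heightOneSpectrum_natCast_mem' (F := F) hp
  obtain ⟨x, hx⟩ := exists_pow_eq_natCast_adicCompletion hα v
  obtain ⟨he, hf⟩ := ramificationIdx_eq_and_inertiaDeg_eq_one_of_pow_eq_prime v hp hv (by omega) x hx hdeg
  have hres : residueChar F v = p := residueChar_eq_of_prime_natCast_mem v hp hv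
  have hndvd : ¬ residueChar F v ∣ v.asIdeal.ramificationIdx ℤ := by
    rw [hres, he]
    intro h
    have h1 : p ∣ 1 := (Nat.dvd_add_right (dvd_refl p)).mp h
    exact hp.one_lt.ne' (Nat.dvd_one.mp h1)
  refine ⟨F, inferInstance, inferInstance, v, hres, he, hf, hndvd, ?_,
    fun k => nonarchIterImage_add_two_eq_empty_of_not_dvd v hndvd k⟩
  rw [hres, he]
  omega

/-- **EXISTENCE AT EVERY ODD PRIME AND EVERY MULTIPLE `e = m·p`, INHABITED SIDE**: for every odd prime `p` and
`m ≥ 1` there are a number field `F` (`= ℚ[X]/(g)`, `g ∣ X^{mp} − p`) and a finite place `v` with `p_v = p`,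
`e(v|p) = m·p`, `f(v|p) = 1` — so `p ∣ e` — at which the honest depth-`2` (Ind3) iterate image for the analytic
logarithms is NONEMPTY (abc-iut-w5-d017's `Real.nonarchIterImage_analyticLogv_two_nonempty_of_dvd`; `m = 1` is this
seat's `ℚ(ᵖ√p)` p425849, `m = 2` is abc-iut-w5-d017's suggested `ℚ(p^{1/2p})`). [claim: Mochizuki2012, status: disputed] -/
theorem exists_numberField_ramificationIdx_eq_mul_nonarchIterImage_two_nonempty {p : ℕ} (hp : p.Prime)
    (hp2 : p ≠ 2) {m : ℕ} (hm : m ≠ 0) :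
    ∃ (F : Type) (_ : Field F) (_ : NumberField F) (v : HeightOneSpectrum (𝓞 F)),
      residueChar F v = p ∧ v.asIdeal.ramificationIdx ℤ = m * p ∧ v.asIdeal.inertiaDeg ℤ = 1 ∧
        residueChar F v ∣ v.asIdeal.ramificationIdx ℤ ∧ ¬ v.asIdeal.ramificationIdx ℤ ≤ residueChar F v - 1 ∧
          (nonarchIterImage (analyticLogv F) v 2).Nonempty := by
  have hmp : m * p ≠ 0 := mul_ne_zero hm hp.ne_zero
  obtain ⟨F, _, _, α, hα, hdeg⟩ := exists_numberField_pow_eq_natCast_finrank_le (n := m * p) hmp p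
  obtain ⟨v, hv⟩ := exists_heightOneSpectrum_natCast_mem' (F := F) hp
  obtain ⟨x, hx⟩ := exists_pow_eq_natCast_adicCompletion hα v
  obtain ⟨he, hf⟩ := ramificationIdx_eq_and_inertiaDeg_eq_one_of_pow_eq_prime v hp hv hmp x hx hdeg
  have hres : residueChar F v = p := residueChar_eq_of_prime_natCast_mem v hp hv
  have hdvd : residueChar F v ∣ v.asIdeal.ramificationIdx ℤ := by
    rw [hres, he]
    exact dvd_mul_left p m
  refine ⟨F, inferInstance, inferInstance, v, hres, he, hf, hdvd, ?_,
    nonarchIterImage_analyticLogv_two_nonempty_of_dvd v (by rw [hres]; exact hp2) hdvd⟩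
  rw [hres, he]
  have h1 : 1 * p ≤ m * p := Nat.mul_le_mul_right p (Nat.one_le_iff_ne_zero.mpr hm)
  omega

/-! ## §2. `p = 2`, `f = 1`, `e = 2k` with `k` odd: EMPTY -/

/-- **EXISTENCE OF DYADIC PLACES `(e, f) = (2k, 1)`, `k` ODD, WITH EMPTY DEPTH `≥ 2`**: for every odd `k` there are a
number field `F` (`= ℚ[X]/(g)`, `g ∣ X^{2k} − 2`) and a finite place `v` with `p_v = 2`, `e(v|2) = 2k`, `f(v|2) = 1`,
at which every honest depth-`≥ 2` (Ind3) iterate image for the analytic logarithms is EMPTY (abc-iut-w5-d017's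
`Real.nonarchIterImage_add_two_eq_empty_of_inertiaDeg_eq_one`; `k = 1` is this seat's `ℚ(√2)` p424522).
[claim: Mochizuki2012, status: disputed] -/
theorem exists_numberField_dyadic_ramificationIdx_eq_two_mul_nonarchIterImage_eq_empty {k : ℕ} (hk : Odd k) :
    ∃ (F : Type) (_ : Field F) (_ : NumberField F) (v : HeightOneSpectrum (𝓞 F)),
      residueChar F v = 2 ∧ v.asIdeal.ramificationIdx ℤ = 2 * k ∧ v.asIdeal.inertiaDeg ℤ = 1 ∧
        ¬ v.asIdeal.ramificationIdx ℤ ≤ residueChar F v - 1 ∧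
          ∀ m : ℕ, nonarchIterImage (analyticLogv F) v (m + 2) = ∅ := by
  have hk0 : k ≠ 0 := by obtain ⟨j, rfl⟩ := hk; omega
  obtain ⟨F, _, _, α, hα, hdeg⟩ := exists_numberField_pow_eq_natCast_finrank_le (n := 2 * k) (by omega) 2
  obtain ⟨v, hv⟩ := exists_heightOneSpectrum_natCast_mem' (F := F) Nat.prime_two
  obtain ⟨x, hx⟩ := exists_pow_eq_natCast_adicCompletion hα v
  obtain ⟨he, hf⟩ := ramificationIdx_eq_and_inertiaDeg_eq_one_of_pow_eq_prime v Nat.prime_two hv (by omega) x hx hdeg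
  have hres : residueChar F v = 2 := residueChar_eq_of_prime_natCast_mem v Nat.prime_two hv
  refine ⟨F, inferInstance, inferInstance, v, hres, he, hf, ?_,
    fun m => nonarchIterImage_add_two_eq_empty_of_inertiaDeg_eq_one v hres hk he hf m⟩
  rw [hres, he]
  omega

/-! ## §3. `p = 2`, `e = f = 2`: the first F-level INHABITED dyadic instance -/

/-- `X⁴ + 2X² + 4` has degree `4`. [folklore] -/
theorem natDegree_X_pow_four_add : (X ^ 4 + C 2 * X ^ 2 + C 4 : ℚ[X]).natDegree = 4 := by
  compute_degree!

/-- **A number field with `ζ₃` and `√2`, of degree `≤ 4`**: `ℚ[X]/(g)`, `g ∣ X⁴ + 2X² + 4`; for a root `θ`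
(`θ² = 2ζ₃`-shaped), `ω := θ²/2` satisfies `ω² + ω + 1 = 0` and `α := −θ³/2` satisfies `α² = 2` (`θ⁶ = 8`).
[cite: Lang2002, Ch. V §2 Prop. 2.3] -/
theorem exists_numberField_sq_two_and_cubeRoot_finrank_le :
    ∃ (F : Type) (_ : Field F) (_ : NumberField F) (α ω : F),
      α ^ 2 = 2 ∧ ω ^ 2 + ω + 1 = 0 ∧ Module.finrank ℚ F ≤ 4 := by
  obtain ⟨F, _, _, θ, hθ, hdeg⟩ := exists_numberField_aeval_eq_zero_finrank_le (X ^ 4 + C 2 * X ^ 2 + C 4 : ℚ[X])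
    (by rw [natDegree_X_pow_four_add]; norm_num)
  have h0 : θ ^ 4 + 2 * θ ^ 2 + 4 = 0 := by
    have h1 : aeval θ (X ^ 4 + C 2 * X ^ 2 + C 4 : ℚ[X]) = θ ^ 4 + 2 * θ ^ 2 + 4 := by
      simp [map_ofNat]
    rw [h1] at hθ
    exact hθ
  refine ⟨F, inferInstance, inferInstance, -θ ^ 3 / 2, θ ^ 2 / 2, ?_, ?_, by rwa [natDegree_X_pow_four_add] at hdeg⟩
  · linear_combination (θ ^ 2 / 4 - 1 / 2) * h0
  · linear_combination h0 / 4

/-- **EXISTENCE OF A DYADIC PLACE `(e, f) = (2, 2)` WITH INHABITED DEPTH `2`**: there are a number field `F`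
(`= ℚ[X]/(g)`, `g ∣ X⁴ + 2X² + 4`, containing `√2` and `ζ₃`) and a finite place `v` with `p_v = 2`, `e(v|2) = 2`,
`f(v|2) = 2` — `2 ≤ e` from `(√2)² = 2`, `2 ≤ f` from `ζ₃`, `e·f ≤ [F:ℚ] ≤ 4` — at which the honest depth-`2` (Ind3)
iterate image for the analytic logarithms is NONEMPTY (abc-iut-w5-d017's
`Real.nonarchIterImage_analyticLogv_two_nonempty_of_two_dvd`), and the tame hypothesis of p414009 fails.
[claim: Mochizuki2012, status: disputed] -/
theorem exists_numberField_dyadic_inertiaDeg_two_nonarchIterImage_two_nonempty :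
    ∃ (F : Type) (_ : Field F) (_ : NumberField F) (v : HeightOneSpectrum (𝓞 F)),
      residueChar F v = 2 ∧ v.asIdeal.ramificationIdx ℤ = 2 ∧ v.asIdeal.inertiaDeg ℤ = 2 ∧
        ¬ v.asIdeal.ramificationIdx ℤ ≤ residueChar F v - 1 ∧
          (nonarchIterImage (analyticLogv F) v 2).Nonempty := by
  obtain ⟨F, _, _, α, ω, hα, hω, hdeg⟩ := exists_numberField_sq_two_and_cubeRoot_finrank_le
  obtain ⟨v, hv⟩ := exists_heightOneSpectrum_natCast_mem' (F := F) Nat.prime_two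
  have hx : (algebraMap F (v.adicCompletion F) α) ^ 2 = 2 := by rw [← map_pow, hα, map_ofNat]
  have hw : (algebraMap F (v.adicCompletion F) ω) ^ 2 + algebraMap F (v.adicCompletion F) ω + 1 = 0 := by
    rw [← map_pow, ← map_add, ← map_one (algebraMap F (v.adicCompletion F)), ← map_add, hω, map_zero]
  have he2 : 2 ≤ v.asIdeal.ramificationIdx ℤ := two_le_ramificationIdx_of_sq v hv _ hx
  have hf2 : 2 ≤ v.asIdeal.inertiaDeg ℤ := two_le_inertiaDeg_of_sq_add_self_add_one_eq_zero v hv _ hw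
  have hef : v.asIdeal.ramificationIdx ℤ * v.asIdeal.inertiaDeg ℤ ≤ 4 :=
    (ramificationIdx_mul_inertiaDeg_le_finrank' v).trans hdeg
  have he : v.asIdeal.ramificationIdx ℤ = 2 := by nlinarith
  have hf : v.asIdeal.inertiaDeg ℤ = 2 := by nlinarith
  have hres : residueChar F v = 2 := residueChar_eq_of_prime_natCast_mem v Nat.prime_two hv
  refine ⟨F, inferInstance, inferInstance, v, hres, he, hf, by rw [hres, he]; omega,
    nonarchIterImage_analyticLogv_two_nonempty_of_two_dvd v hres (by rw [he]) (by rw [hf])⟩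

end Summit.ABC.IUTFork.Thm311.Real

end
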